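import Summits.Parity.GeneralizedHardyLittlewood.Theses.LiouvilleMAD

/-!
# Route LiouvilleMAD — the Assembly item (stmt-Parity-14997)

`Assembly` is the type of the route's crux-only deciding theorem `closes`:
`CosetDecorrelation → FanDecorrelation → ElliottHalberstam → EngineToGHL →
GeneralizedHardyLittlewood`.  It is pure logic: the one-piece downstream crux `EngineToGHL`
is the conjunction of the four reductions
`(CosetDecorrelation → FanDecorrelation → DilatedChowla)`, `(DilatedChowla → TypeIILiouville)`,
`(TypeIILiouville → LambdaLiouvilleLevel)`, `(LambdaLiouvilleLevel → ElliottHalberstam → PairsHL)`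
with the complementary sector `(PairsHL → GeneralizedHardyLittlewood)`; threading the two MAD
cruxes and the bridge premise `ElliottHalberstam` through these five conjuncts gives the
sub-problem statement (the same term as `closes`).
-/

namespace Summit.Parity.GeneralizedHardyLittlewood.Theorems

/-- The Assembly item of route LiouvilleMAD (stmt-Parity-14997): the implication chain
`CosetDecorrelation → FanDecorrelation → ElliottHalberstam → EngineToGHL →
GeneralizedHardyLittlewood` holds by composing the hypotheses — the five conjuncts of the
downstream crux `EngineToGHL` take the two MAD cruxes to `DilatedChowla`, then to
`TypeIILiouville`, then to `LambdaLiouvilleLevel`, then (with the bridge premise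
`ElliottHalberstam`) to Hardy–Littlewood pairs at every fixed shift, and finally to
`GeneralizedHardyLittlewood` (literally the term of the deciding theorem `closes`). -/
theorem liouvilleMADAssembly_proof :
    Summit.Parity.GeneralizedHardyLittlewood.Theses.LiouvilleMAD.Assembly := by
  unfold Summit.Parity.GeneralizedHardyLittlewood.Theses.LiouvilleMAD.Assembly
  intro h₁ h₂ hEH hX
  exact hX.2.2.2.2 (hX.2.2.2.1 (hX.2.2.1 (hX.2.1 (hX.1 h₁ h₂))) hEH)

end Summit.Parity.GeneralizedHardyLittlewood.Theorems
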